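import Summits.AtomisticToContinuum.Crystallization.Theorems.ChessboardParticlePlanesPeriodicWindowsHcCompetitor
import Summits.AtomisticToContinuum.Crystallization.Theorems.ChessboardParticlePlanesPeriodicWindowsHcHkArith
import Summits.AtomisticToContinuum.Crystallization.Theorems.ChessboardParticlePlanesPeriodicWindowsStubGapSqueeze
import Summits.AtomisticToContinuum.Crystallization.Theorems.ChessboardParticlePlanesPeriodicWindowsHcWideGapSyndetic
import Summits.AtomisticToContinuum.Crystallization.Theorems.ChessboardParticlePlanesPeriodicWindowsHcBadOffsetSyndetic
import Summits.AtomisticToContinuum.Crystallization.Theorems.ChessboardParticlePlanesPeriodicWindowsHcFarOfNotHollow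

/-!
# Crux `PeriodicWindows` (stmt-AtomisticToContinuum-3240), line `dense-laminar-hull` — HC `hollow closing` FROM THE TWO CERTIFICATES
# (`hc_hollowClosing_of_certs`; lead c12; numerics-free)

The registry-over-the-offset-torus half of P3b2′ together with the second gap squeeze, reduced to the two certificate statements
E1★ (`hc_cert_landscape`, registered stub: zeroth-order landscape grid + local analytic hollow coercivity) and E2 (`hc_cert_farLayer`,
registered stub: sup-quadratic constants of far layers), which enter as HYPOTHESES. Everything else — the combined competitor
(`hc_competitor`, `hc_blockSum`, `hc_farPair`), the syndeticity inputs (`hc_badOffsetSyndetic`, `hc_wideGapSyndetic`,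
`hc_farOfNotHollow`), the competitor data (`hc_compressedHeights`, `hcA_offsets`), the prisms (`stub_layeredPrisms`), the window
bounds (U)/(L) of item 11779 and the counting — is proved. See the docstring of `hc_hollowClosing_of_certs`. [folklore]
-/

noncomputable section

namespace Summit.AtomisticToContinuum.Crystallization.Theorems.PeriodicWindowsDenseLaminarHull

open Literature.MathematicalPhysics.StatisticalMechanics Filter Metric
open scoped BigOperators

/-- Vector-valued antiderivative on `ℤ`: for every `w` there is `P` with `P 0 = 0` and `P (m+1) - P m = w m`. [folklore] -/
theorem hcA_antideriv (w : ℤ → EuclideanSpace ℝ (Fin 3)) :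
    ∃ P : ℤ → EuclideanSpace ℝ (Fin 3), P 0 = 0 ∧ ∀ m : ℤ, P (m + 1) - P m = w m := by
  set up : ℕ → EuclideanSpace ℝ (Fin 3) := fun n => ∑ k ∈ Finset.range n, w (k : ℤ) with hup
  set dn : ℕ → EuclideanSpace ℝ (Fin 3) := fun n => ∑ k ∈ Finset.range n, w (-(k : ℤ) - 1) with hdn
  refine ⟨fun m => if 0 ≤ m then up m.toNat else -dn (-m).toNat, by simp [hup], fun m => ?_⟩
  have hup_succ : ∀ n : ℕ, up (n + 1) - up n = w (n : ℤ) := fun n => by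
    simp only [hup, Finset.sum_range_succ]; abel
  have hdn_succ : ∀ n : ℕ, dn (n + 1) - dn n = w (-(n : ℤ) - 1) := fun n => by
    simp only [hdn, Finset.sum_range_succ]; abel
  rcases lt_trichotomy m (-1) with hm | rfl | hm
  · have h1 : ¬ (0 ≤ m + 1) := by omega
    have h2 : ¬ (0 ≤ m) := by omega
    simp only [h1, h2, if_false]
    obtain ⟨n, hn⟩ : ∃ n : ℕ, (-(m + 1)).toNat = n := ⟨_, rfl⟩
    have hn' : (-m).toNat = n + 1 := by omega
    have hmn : -(n : ℤ) - 1 = m := by omega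
    rw [hn, hn', show -dn n - -dn (n + 1) = dn (n + 1) - dn n by abel, hdn_succ n, hmn]
  · simp only [show (-1 : ℤ) + 1 = 0 by norm_num, le_refl, if_true, Int.toNat_zero,
      show ¬ ((0 : ℤ) ≤ -1) by norm_num, if_false, sub_neg_eq_add]
    have h0 : up 0 = 0 := by simp [hup]
    have h1 : dn (0 + 1) - dn 0 = w (-(0 : ℕ) - 1) := hdn_succ 0
    have h2 : dn 0 = 0 := by simp [hdn]
    rw [h2, sub_zero] at h1
    rw [h0, zero_add, show (-(-1 : ℤ)).toNat = 0 + 1 by norm_num, h1]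
    norm_num
  · have h1 : 0 ≤ m + 1 := by omega
    have h2 : 0 ≤ m := by omega
    simp only [h1, h2, if_true]
    obtain ⟨n, hn⟩ : ∃ n : ℕ, m.toNat = n := ⟨_, rfl⟩
    have hn' : (m + 1).toNat = n + 1 := by omega
    have hmn : (n : ℤ) = m := by omega
    rw [hn, hn', hup_succ n, hmn]

/-- **Competitor offsets**: hollow steps `w m` (horizontal) integrate to offsets `δ'` in a fundamental cell (`‖δ' m‖ ≤ 2a`), horizontal,
with `δ' (m+1) - δ' m = w m` up to the lattice. [folklore] -/
theorem hcA_offsets {a : ℝ} (ha : 0 < a) (w : ℤ → EuclideanSpace ℝ (Fin 3)) (hw : ∀ m, (w m) 2 = 0) :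
    ∃ δ' : ℤ → EuclideanSpace ℝ (Fin 3), (∀ m : ℤ, (δ' m) 2 = 0) ∧ (∀ m : ℤ, ‖δ' m‖ ≤ 2 * a) ∧
      ∀ m : ℤ, ∃ i j : ℤ, δ' (m + 1) - δ' m = w m + (i : ℝ) • triangularVec₁ a + (j : ℝ) • triangularVec₂ a := by
  obtain ⟨P, hP0, hP⟩ := hcA_antideriv w
  have hP2 : ∀ m : ℤ, (P m) 2 = 0 := by
    have hstep : ∀ m : ℤ, (P (m + 1)) 2 = (P m) 2 := fun m => by
      have h := congrArg (fun v : EuclideanSpace ℝ (Fin 3) => v 2) (hP m)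
      simp only [PiLp.sub_apply, hw] at h
      linarith
    intro m
    induction m using Int.induction_on with
    | zero => rw [hP0]; rfl
    | succ n ih => rw [hstep, ih]
    | pred n ih =>
      have h := hstep (-(n : ℤ) - 1)
      rw [show -(n : ℤ) - 1 + 1 = -(n : ℤ) by ring] at h
      rw [← h]; exact ih
  choose c₁ c₂ hc using fun m => gsc_cover ha (P m) (hP2 m)
  refine ⟨fun m => P m - ((c₁ m : ℝ) • triangularVec₁ a + (c₂ m : ℝ) • triangularVec₂ a), fun m => ?_, hc, fun m => ?_⟩
  · rw [PiLp.sub_apply, PiLp.add_apply, PiLp.smul_apply, PiLp.smul_apply, hP2, gsc_triangularVec₁_two,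
      gsc_triangularVec₂_two]
    simp
  · refine ⟨c₁ m - c₁ (m + 1), c₂ m - c₂ (m + 1), ?_⟩
    rw [← hP m]
    push_cast
    module

/-- **Reducing the offsets with explicit lattice shifts** (variant of `gs_reduce_offsets`): the reduced offsets differ from the
original ones by lattice vectors, lie in a fundamental cell and define the same layered set for every height function. [folklore] -/
theorem hcA_reduce {a : ℝ} (ha : 0 < a) (B : EuclideanSpace ℝ (Fin 3) ≃ₗᵢ[ℝ] EuclideanSpace ℝ (Fin 3))
    (δ : ℤ → EuclideanSpace ℝ (Fin 3)) (hδ : ∀ m : ℤ, (δ m) 2 = 0) :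
    ∃ δ' : ℤ → EuclideanSpace ℝ (Fin 3), (∀ m : ℤ, (δ' m) 2 = 0) ∧ (∀ m : ℤ, ‖δ' m‖ ≤ 2 * a) ∧
      (∀ m : ℤ, ∃ i j : ℤ, δ' m = δ m - ((i : ℝ) • triangularVec₁ a + (j : ℝ) • triangularVec₂ a)) ∧
      ∀ w : ℤ → ℝ, (fun p => B p) '' {p | ∃ m i j : ℤ, p = ((i : ℝ) • triangularVec₁ a) +
          ((j : ℝ) • triangularVec₂ a) + δ m + (w m • layerNormal 1)} =
        (fun p => B p) '' {p | ∃ m i j : ℤ, p = ((i : ℝ) • triangularVec₁ a) +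
          ((j : ℝ) • triangularVec₂ a) + δ' m + (w m • layerNormal 1)} := by
  choose c₁ c₂ hc using fun m => gsc_cover ha (δ m) (hδ m)
  refine ⟨fun m => δ m - ((c₁ m : ℝ) • triangularVec₁ a + (c₂ m : ℝ) • triangularVec₂ a), fun m => ?_, hc,
    fun m => ⟨c₁ m, c₂ m, rfl⟩, fun w => ?_⟩
  · rw [PiLp.sub_apply, PiLp.add_apply, PiLp.smul_apply, PiLp.smul_apply, hδ, gsc_triangularVec₁_two,
      gsc_triangularVec₂_two]
    simp
  · ext q
    constructor
    · rintro ⟨p, ⟨m, i, j, rfl⟩, rfl⟩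
      refine ⟨_, ⟨m, i + c₁ m, j + c₂ m, rfl⟩, ?_⟩
      dsimp only
      congr 1
      push_cast
      module
    · rintro ⟨p, ⟨m, i, j, rfl⟩, rfl⟩
      refine ⟨_, ⟨m, i - c₁ m, j - c₂ m, rfl⟩, ?_⟩
      dsimp only
      congr 1
      push_cast
      module

/-- **`hc_hollowClosing_of_certs` — HC (hollow closing) from the two certificates** (lead c12; numerics-free). Given the
landscape certificate E1★ (`hc_cert_landscape`: `Φ(a,g,θ) − Φ(a,min(g,ĝ(a)),w) ≥ (1/5)‖θ − w‖² + (g − ĝ(a))₊²` for the nearest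
hollow vector `w`, `a ∈ [93/100, 51/50]`, `g ∈ [3/4, 1]`) and the far-layer certificate E2 (`hc_cert_farLayer`: the quadratic table
`h_k`), every rooted, rooted-uniformly recurrent, exactly laminar, separated rotated-hull point of a ground-state sequence which is a
general layered set of spacing `a ∈ [93/100, 51/50]` with gaps in `[3/4, 1]` has ALL consecutive offsets in the hollow classes
`{±b} + ℤv₁ + ℤv₂` and ALL gaps `≤ ĝ(a) = √(1 − a²/3)`. Density closing with the combined competitor: a non-hollow offset is
`2η`-far from the classes (`hc_farOfNotHollow`) hence `η`-far offsets are syndetic (`hc_badOffsetSyndetic`), a gap `> ĝ` makes gaps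
`≥ ĝ + Δ` syndetic (`hc_wideGapSyndetic`); the competitor (offsets integrated from the nearest hollow vectors and reduced to a cell,
`hcA_offsets`; heights `ĝ`-compressed, `hc_compressedHeights`) is `7/10`-separated, its prisms and those of `Z` have `nK²` points and
boundary functional `O(nK + K²)` (`stub_layeredPrisms`), and `hc_competitor` (with `hc_hk_arith`) gives
`E(W) − E(W') ≥ K² (γ · #bad − 22a²/5)`; the window bounds (U) `LayeredHull.wb_upper` (translation hull, `gs_hull_translate`) and (L)
`wb_lower` at equal cardinality leave `γ n' ≤ 2(|C_U| + |C_L|) C_b + 22a²/5` — false for `n'` large (`LayeredHull.clo_count`).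
[folklore] -/
theorem hc_hollowClosing_of_certs : (∀ a : ℝ, 93 / 100 ≤ a → a ≤ 51 / 50 → ∀ g : ℝ, (3 : ℝ) / 4 ≤ g → g ≤ 1 → ∀ θ : EuclideanSpace ℝ (Fin 3), θ 2 = 0 → ∃ w : EuclideanSpace ℝ (Fin 3), (∃ s i j : ℤ, (s = 1 ∨ s = -1) ∧ w = (s : ℝ) • barlowOffset a + (i : ℝ) • triangularVec₁ a + (j : ℝ) • triangularVec₂ a) ∧ ‖θ - w‖ ≤ a ∧ (1 / 5 : ℝ) * ‖θ - w‖ ^ 2 + 1 * (max (g - Real.sqrt (1 - a ^ 2 / 3)) 0) ^ 2 ≤ (∑' ij : ℤ × ℤ, lennardJones ‖((ij.1 : ℝ)) • triangularVec₁ a + ((ij.2 : ℝ)) • triangularVec₂ a + θ + g • layerNormal 1‖) - (∑' ij : ℤ × ℤ, lennardJones ‖((ij.1 : ℝ)) • triangularVec₁ a + ((ij.2 : ℝ)) • triangularVec₂ a + w + (min g (Real.sqrt (1 - a ^ 2 / 3))) • layerNormal 1‖)) →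
    (∀ a : ℝ, 93 / 100 ≤ a → a ≤ 51 / 50 → ∀ (k : ℕ) (H : ℝ), 2 ≤ k → (3 : ℝ) / 4 * k ≤ |H| → ∀ (w ξ : EuclideanSpace ℝ (Fin 3)), (w = 0 ∨ w = barlowOffset a ∨ w = -barlowOffset a) → ξ 2 = 0 → ‖ξ‖ ≤ 2 * a → |(∑' ij : ℤ × ℤ, lennardJones ‖((ij.1 : ℝ)) • triangularVec₁ a + ((ij.2 : ℝ)) • triangularVec₂ a + (w + ξ) + H • layerNormal 1‖) - (∑' ij : ℤ × ℤ, lennardJones ‖((ij.1 : ℝ)) • triangularVec₁ a + ((ij.2 : ℝ)) • triangularVec₂ a + w + H • layerNormal 1‖)| ≤ (if k ≤ 2 then (1 : ℝ) / 250 else if k ≤ 10 then 1 / 12500 else 24 / ((3 : ℝ) / 4 * k) ^ 6) * ‖ξ‖ ^ 2) →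
    ∀ ρ₀ : ℝ, 0 < ρ₀ →
    ∀ x : (N : ℕ) → (Fin N → EuclideanSpace ℝ (Fin 3)), (∀ N, IsGroundState lennardJones (x N)) →
    ∀ Z : Set (EuclideanSpace ℝ (Fin 3)), (0 : EuclideanSpace ℝ (Fin 3)) ∈ Z →
    (∃ (σ : ℕ → ℕ) (τ : ℕ → EuclideanSpace ℝ (Fin 3))
        (A : ℕ → (EuclideanSpace ℝ (Fin 3) ≃ₗᵢ[ℝ] EuclideanSpace ℝ (Fin 3))),
      StrictMono σ ∧ ∀ R ε : ℝ, 0 < ε → ∀ᶠ j in Filter.atTop,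
        BallMatch ε R 0 (Set.range fun i => A j (x (σ j) i) + τ j) Z) →
    (∀ c : EuclideanSpace ℝ (Fin 3), ∃ p ∈ Z, dist p c ≤ ρ₀) →
    (∀ p ∈ Z, ∀ q ∈ Z, p 2 ≠ q 2 → (3 : ℝ) / 4 ≤ |p 2 - q 2|) →
    (∀ p ∈ Z, ∀ q ∈ Z, p ≠ q → (7 : ℝ) / 10 ≤ dist p q) →
    (∀ R ε : ℝ, 0 < ε → ∃ G : ℝ, ∀ w ∈ Z, ∃ g ∈ Z, dist g w ≤ G ∧
      BallMatch ε R 0 ((fun p => p - g) '' Z) Z) →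
    ∀ a : ℝ, 0 < a →
    ∀ (B : EuclideanSpace ℝ (Fin 3) ≃ₗᵢ[ℝ] EuclideanSpace ℝ (Fin 3)) (δ : ℤ → EuclideanSpace ℝ (Fin 3)) (z : ℤ → ℝ),
    (∀ p : EuclideanSpace ℝ (Fin 3), (B p) 2 = p 2) → (∀ m : ℤ, (δ m) 2 = 0) → δ 0 = 0 → z 0 = 0 → StrictMono z →
    (∀ m : ℤ, (3 : ℝ) / 4 ≤ z (m + 1) - z m) → (∀ m : ℤ, z (m + 1) - z m ≤ 2 * ρ₀) →
    Z = (fun p => B p) '' {p | ∃ m i j : ℤ, p = ((i : ℝ) • triangularVec₁ a) +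
      ((j : ℝ) • triangularVec₂ a) + δ m + (z m • layerNormal 1)} →
    (∀ m : ℤ, z (m + 1) - z m ≤ 1) →
    93 / 100 ≤ a → a ≤ 51 / 50 →
    (∀ m : ℤ, ∃ s i j : ℤ, (s = 1 ∨ s = -1) ∧ δ (m + 1) - δ m =
      (s : ℝ) • barlowOffset a + (i : ℝ) • triangularVec₁ a + (j : ℝ) • triangularVec₂ a) ∧
    (∀ m : ℤ, z (m + 1) - z m ≤ Real.sqrt (1 - a ^ 2 / 3)) := by
  classical
  intro hc_cert_landscape hc_cert_farLayer ρ₀ _hρ₀ x hx Z _h0 hhull _hdense _hlam _hsep hrec a ha B δ z hB hδ _hδ0 _hz0 hz hgap _hgap' hZ hsq ha1 ha2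
  have ha7 : (7 : ℝ) / 10 ≤ a := by linarith
  -- the threshold `t = ĝ(a)`
  obtain ⟨t, htdef⟩ : ∃ t : ℝ, t = Real.sqrt (1 - a ^ 2 / 3) := ⟨_, rfl⟩
  have ht34 : (3 : ℝ) / 4 ≤ t := by
    rw [htdef, show (3 : ℝ) / 4 = Real.sqrt (((3 : ℝ) / 4) ^ 2) by rw [Real.sqrt_sq]; norm_num]
    exact Real.sqrt_le_sqrt (by nlinarith)
  rw [← htdef]
  -- (0) offsets in a fundamental cell, with explicit lattice shifts
  obtain ⟨δ₁, hδ₁, hδ₁D, hshift, hreidx⟩ := hcA_reduce ha B δ hδ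
  have hZ₁ : Z = (fun p => B p) '' {p | ∃ m i j : ℤ, p = ((i : ℝ) • triangularVec₁ a) +
      ((j : ℝ) • triangularVec₂ a) + δ₁ m + (z m • layerNormal 1)} := by rw [hZ]; exact hreidx z
  have hθ₁2 : ∀ m : ℤ, (δ₁ (m + 1) - δ₁ m) 2 = 0 := fun m => by rw [PiLp.sub_apply, hδ₁, hδ₁, sub_zero]
  -- (1) the landscape certificate at every interface
  have hE1 := fun m : ℤ => hc_cert_landscape a ha1 ha2 (z (m + 1) - z m) (hgap m) (hsq m) (δ₁ (m + 1) - δ₁ m) (hθ₁2 m)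
  choose w hwcls hwd hwineq using hE1
  have hw2 : ∀ m : ℤ, (w m) 2 = 0 := fun m => by
    obtain ⟨s, i, j, -, hwm⟩ := hwcls m
    rw [hwm]; exact hcC_class_two a _ _ _
  -- it suffices to show: every reduced offset is hollow and every gap is `≤ t`
  suffices hmain : (∀ m : ℤ, ∃ s i j : ℤ, (s = 1 ∨ s = -1) ∧ δ₁ (m + 1) - δ₁ m =
      (s : ℝ) • barlowOffset a + (i : ℝ) • triangularVec₁ a + (j : ℝ) • triangularVec₂ a) ∧
      (∀ m : ℤ, z (m + 1) - z m ≤ t) by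
    refine ⟨fun m => ?_, hmain.2⟩
    obtain ⟨s, i, j, hs, hm⟩ := hmain.1 m
    obtain ⟨i₀, j₀, h₀⟩ := hshift m
    obtain ⟨i₁, j₁, h₁⟩ := hshift (m + 1)
    refine ⟨s, i + i₁ - i₀, j + j₁ - j₀, hs, ?_⟩
    have e : δ (m + 1) - δ m = (δ₁ (m + 1) - δ₁ m) + (((i₁ : ℝ) • triangularVec₁ a + (j₁ : ℝ) • triangularVec₂ a) -
        ((i₀ : ℝ) • triangularVec₁ a + (j₀ : ℝ) • triangularVec₂ a)) := by rw [h₀, h₁]; abel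
    rw [e, hm]
    push_cast
    module
  -- (2) THE ENGINE: a syndetic family of interfaces with gain `≥ γ > 0` is impossible
  have engine : ∀ (P : ℤ → Prop) (γ : ℝ), 0 < γ →
      (∀ m : ℤ, P m → γ ≤ (1 / 5 : ℝ) * ‖(δ₁ (m + 1) - δ₁ m) - w m‖ ^ 2 + 1 * (max (z (m + 1) - z m - t) 0) ^ 2) →
      (∃ G : ℕ, ∀ m : ℤ, ∃ g : ℤ, 0 ≤ g ∧ g ≤ G ∧ P (m + g)) → False := by
    intro P γ hγ hPgain hsynd
    obtain ⟨G, hG⟩ := hsynd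
    -- competitor data
    obtain ⟨δ', hδ'2, hδ'D, hδ'w⟩ := hcA_offsets ha w hw2
    obtain ⟨z', _hz'0, hz', hz'mono, hgapz', _hgapz't, _hblk, _hblk'⟩ := hc_compressedHeights.1 z t ht34 hgap
    obtain ⟨Z', hZ'def⟩ : ∃ Z' : Set (EuclideanSpace ℝ (Fin 3)), Z' = (fun p => B p) '' {p | ∃ m i j : ℤ,
        p = ((i : ℝ) • triangularVec₁ a) + ((j : ℝ) • triangularVec₂ a) + δ' m + (z' m • layerNormal 1)} := ⟨_, rfl⟩
    have hsepZ' := hc_compressedHeights.2 a ha7 B δ' z' hB hδ'2 hz'mono hgapz' Z' hZ'def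
    -- prisms (GS2) for `Z` and `Z'`
    obtain ⟨CZ, hprism⟩ := stub_layeredPrisms a (2 * a) ha B δ₁ z hB hδ₁ hδ₁D hz hgap
    obtain ⟨CZ', hprism'⟩ := stub_layeredPrisms a (2 * a) ha B δ' z' hB hδ'2 hδ'D hz'mono hgapz'
    -- window bounds: (U) for `Z` (translation hull of the rotated ground states), (L) for `Z'`
    obtain ⟨CU, hU⟩ := LayeredHull.wb_upper
    obtain ⟨x₁, hx₁, hH⟩ := gs_hull_translate hx hhull
    obtain ⟨CL, hL⟩ := LayeredHull.wb_lower (7 / 10) (by norm_num)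
    -- the far-layer table and its arithmetic
    obtain ⟨hk0, hksmall, hkbdry⟩ := hc_hk_arith
    -- sizes
    obtain ⟨Cb, hCb⟩ : ∃ Cb : ℝ, Cb = |CZ| + |CZ'| := ⟨_, rfl⟩
    have hCb0 : 0 ≤ Cb := by rw [hCb]; positivity
    have hCZ : |CZ| ≤ Cb := by rw [hCb]; linarith [abs_nonneg CZ']
    have hCZ' : |CZ'| ≤ Cb := by rw [hCb]; linarith [abs_nonneg CZ]
    obtain ⟨n', hn'⟩ := exists_nat_gt ((2 * ((|CU| + |CL|) * Cb) + (2 * 2 + 2 * (1 / 5)) * a ^ 2) / γ)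
    have hn'pos : 0 < n' := by
      have h0 : (0 : ℝ) ≤ (2 * ((|CU| + |CL|) * Cb) + (2 * 2 + 2 * (1 / 5)) * a ^ 2) / γ := by positivity
      exact_mod_cast h0.trans_lt hn'
    obtain ⟨n, hndef⟩ : ∃ n : ℕ, n = n' * (G + 1) := ⟨_, rfl⟩
    have hnpos : 0 < n := by rw [hndef]; exact Nat.mul_pos hn'pos (Nat.succ_pos G)
    have hKpos : (0 : ℝ) < (n : ℝ) := by exact_mod_cast hnpos
    -- the competitor inequality on the block `[0, n) × [0, n)²`
    have hcomp := hc_competitor a t (1 / 5) 1 2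
      (fun k : ℕ => if k ≤ 2 then (1 : ℝ) / 250 else if k ≤ 10 then 1 / 12500 else 24 / ((3 : ℝ) / 4 * k) ^ 6)
      ha7 ht34 (by norm_num) (by norm_num) (by norm_num) hk0 hksmall hkbdry
      (fun k H hk hHk w' ξ hw' hξ hξn => hc_cert_farLayer a ha1 ha2 k H hk hHk w' ξ hw' hξ hξn)
      B δ₁ δ' w z z' hB hδ₁ hδ'2 hz hgap hsq hz' hwcls hδ'w hwd
      (fun m => by rw [hz' m]; have h := hwineq m; rwa [← htdef] at h) 0 n n
    -- the parametrisations of `Z` and `Z'` by `ℤ × ℕ × ℕ` and the index box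
    obtain ⟨Q, hQ⟩ : ∃ Q : ℤ × (ℕ × ℕ) → EuclideanSpace ℝ (Fin 3), Q = fun t => B (((t.2.1 : ℝ) • triangularVec₁ a) +
      ((t.2.2 : ℝ) • triangularVec₂ a) + δ₁ t.1 + (z t.1 • layerNormal 1)) := ⟨_, rfl⟩
    obtain ⟨Q', hQ'⟩ : ∃ Q' : ℤ × (ℕ × ℕ) → EuclideanSpace ℝ (Fin 3), Q' = fun t => B (((t.2.1 : ℝ) • triangularVec₁ a) +
      ((t.2.2 : ℝ) • triangularVec₂ a) + δ' t.1 + (z' t.1 • layerNormal 1)) := ⟨_, rfl⟩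
    obtain ⟨box, hbox⟩ : ∃ box : Finset (ℤ × (ℕ × ℕ)),
      box = (Finset.Ico (0 : ℤ) (0 + n)) ×ˢ ((Finset.range n) ×ˢ (Finset.range n)) := ⟨_, rfl⟩
    have hQt : ∀ (m : ℤ) (i j : ℕ), Q (m, (i, j)) = B ((((i : ℤ) : ℝ)) • triangularVec₁ a +
        (((j : ℤ) : ℝ)) • triangularVec₂ a + δ₁ m + (z m • layerNormal 1)) := fun m i j => by
      rw [hQ]; simp
    have hQ't : ∀ (m : ℤ) (i j : ℕ), Q' (m, (i, j)) = B ((((i : ℤ) : ℝ)) • triangularVec₁ a +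
        (((j : ℤ) : ℝ)) • triangularVec₂ a + δ' m + (z' m • layerNormal 1)) := fun m i j => by
      rw [hQ']; simp
    have hinjQ : Function.Injective Q := by
      rintro ⟨m, i, j⟩ ⟨m', i', j'⟩ h
      rw [hQt, hQt] at h
      have := gsc_param_injective (a := a) ha hB hδ₁ hz.injective (a₁ := (m, (i : ℤ), (j : ℤ)))
        (a₂ := (m', (i' : ℤ), (j' : ℤ))) h
      simp only [Prod.mk.injEq, Nat.cast_inj] at this
      rw [this.1, this.2.1, this.2.2]
    have hinjQ' : Function.Injective Q' := by
      rintro ⟨m, i, j⟩ ⟨m', i', j'⟩ h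
      rw [hQ't, hQ't] at h
      have := gsc_param_injective (a := a) ha hB hδ'2 hz'mono.injective (a₁ := (m, (i : ℤ), (j : ℤ)))
        (a₂ := (m', (i' : ℤ), (j' : ℤ))) h
      simp only [Prod.mk.injEq, Nat.cast_inj] at this
      rw [this.1, this.2.1, this.2.2]
    -- the two prisms with `m₁ = 0`, `n` layers, `K = n` (GS2)
    obtain ⟨hWsub, hWcard, hWbd⟩ := hprism 0 n n Z hZ₁ (box.image Q) (by rw [hbox, hQ])
    obtain ⟨hW'sub, hW'card, hW'bd⟩ := hprism' 0 n n Z' hZ'def (box.image Q') (by rw [hbox, hQ'])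
    -- (U) and (L), boundary terms absorbed
    have hbd0 : ∀ (S : Set (EuclideanSpace ℝ (Fin 3))) (W : Finset (EuclideanSpace ℝ (Fin 3))),
        0 ≤ ∑ p ∈ W, (1 + Metric.infDist p (S \ (↑W : Set (EuclideanSpace ℝ (Fin 3)))))⁻¹ ^ 3 := fun S W =>
      Finset.sum_nonneg fun p _ => pow_nonneg (inv_nonneg.2 (add_nonneg zero_le_one Metric.infDist_nonneg)) 3
    have hnn : (0 : ℝ) ≤ (n : ℝ) * n + (n : ℝ) ^ 2 := by positivity
    have hWbd' : ∑ p ∈ box.image Q, (1 + Metric.infDist p (Z \ (↑(box.image Q) : Set (EuclideanSpace ℝ (Fin 3)))))⁻¹ ^ 3 ≤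
        Cb * ((n : ℝ) * n + (n : ℝ) ^ 2) := by
      refine hWbd.trans ?_
      have h1 : CZ * ((n : ℝ) * n + (n : ℝ) ^ 2) ≤ |CZ| * ((n : ℝ) * n + (n : ℝ) ^ 2) :=
        mul_le_mul_of_nonneg_right (le_abs_self _) hnn
      exact h1.trans (mul_le_mul_of_nonneg_right hCZ hnn)
    have hW'bd' : ∑ p ∈ box.image Q', (1 + Metric.infDist p (Z' \ (↑(box.image Q') : Set (EuclideanSpace ℝ (Fin 3)))))⁻¹ ^ 3 ≤
        Cb * ((n : ℝ) * n + (n : ℝ) ^ 2) := by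
      refine hW'bd.trans ?_
      have h1 : CZ' * ((n : ℝ) * n + (n : ℝ) ^ 2) ≤ |CZ'| * ((n : ℝ) * n + (n : ℝ) ^ 2) :=
        mul_le_mul_of_nonneg_right (le_abs_self _) hnn
      exact h1.trans (mul_le_mul_of_nonneg_right hCZ' hnn)
    have hUw := hU x₁ hx₁ Z hH (box.image Q) hWsub
    have hLw := hL Z' hsepZ' (box.image Q') hW'sub
    rw [hWcard] at hUw
    rw [hW'card] at hLw
    have hUw' := LayeredHull.clo_absorb_upper hUw hWbd' (hbd0 _ _)
    have hLw' := LayeredHull.clo_absorb_lower hLw hW'bd' (hbd0 _ _)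
    -- the two prism sums as sums over the index box
    rw [Finset.sum_image fun t _ t' _ h => hinjQ h] at hUw'
    rw [Finset.sum_image fun t _ t' _ h => hinjQ' h] at hLw'
    -- the competitor inequality in the same form
    have hcomp' : (n : ℝ) ^ 2 * ((∑ m ∈ Finset.Ico (0 : ℤ) (0 + n),
        ((1 / 5 : ℝ) * ‖(δ₁ (m + 1) - δ₁ m) - w m‖ ^ 2 + 1 * (max (z (m + 1) - z m - t) 0) ^ 2)) -
        (2 * 2 + 2 * (1 / 5)) * a ^ 2) ≤
        (∑ t ∈ box, ∑' q : {q : EuclideanSpace ℝ (Fin 3) // q ∈ Z ∧ q ≠ Q t}, lennardJones (dist (Q t) (q : EuclideanSpace ℝ (Fin 3)))) -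
        (∑ t ∈ box, ∑' q : {q : EuclideanSpace ℝ (Fin 3) // q ∈ Z' ∧ q ≠ Q' t}, lennardJones (dist (Q' t) (q : EuclideanSpace ℝ (Fin 3)))) := by
      rw [hbox, hQ, hQ', hZ₁, hZ'def]
      beta_reduce
      exact hcomp
    -- counting the bad interfaces in the block
    have hgain_m : ∀ m : ℤ, (if P m then (1 : ℝ) else 0) * γ ≤
        (1 / 5 : ℝ) * ‖(δ₁ (m + 1) - δ₁ m) - w m‖ ^ 2 + 1 * (max (z (m + 1) - z m - t) 0) ^ 2 := by
      intro m
      split_ifs with hm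
      · rw [one_mul]; exact hPgain m hm
      · rw [zero_mul]; positivity
    have hcount : (n' : ℝ) ≤ ∑ m ∈ Finset.Ico (0 : ℤ) (0 + ((n' * (G + 1) : ℕ) : ℤ)), (if P m then (1 : ℝ) else 0) :=
      LayeredHull.clo_count P G 0 (fun m => hG m) n'
    rw [← hndef] at hcount
    have hgain : γ * n' ≤ ∑ m ∈ Finset.Ico (0 : ℤ) (0 + n),
        ((1 / 5 : ℝ) * ‖(δ₁ (m + 1) - δ₁ m) - w m‖ ^ 2 + 1 * (max (z (m + 1) - z m - t) 0) ^ 2) := by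
      have h1 := Finset.sum_le_sum fun m (_ : m ∈ Finset.Ico (0 : ℤ) (0 + n)) => hgain_m m
      rw [← Finset.sum_mul] at h1
      nlinarith [mul_le_mul_of_nonneg_right hcount hγ.le]
    -- the energy inequality, divided by `n² > 0`
    have hK2 : (0 : ℝ) < (n : ℝ) ^ 2 := by positivity
    have h1 : (n : ℝ) ^ 2 * (γ * n' - (2 * 2 + 2 * (1 / 5)) * a ^ 2) ≤ (n : ℝ) ^ 2 *
        ((∑ m ∈ Finset.Ico (0 : ℤ) (0 + n),
          ((1 / 5 : ℝ) * ‖(δ₁ (m + 1) - δ₁ m) - w m‖ ^ 2 + 1 * (max (z (m + 1) - z m - t) 0) ^ 2)) -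
          (2 * 2 + 2 * (1 / 5)) * a ^ 2) := mul_le_mul_of_nonneg_left (by linarith only [hgain]) hK2.le
    have e1 : (|CU| + |CL|) * (Cb * ((n : ℝ) * n + (n : ℝ) ^ 2)) =
        |CU| * (Cb * ((n : ℝ) * n + (n : ℝ) ^ 2)) + |CL| * (Cb * ((n : ℝ) * n + (n : ℝ) ^ 2)) := by ring
    have htot : (n : ℝ) ^ 2 * (γ * n' - (2 * 2 + 2 * (1 / 5)) * a ^ 2) ≤
        (|CU| + |CL|) * (Cb * ((n : ℝ) * n + (n : ℝ) ^ 2)) := by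
      rw [e1]; linarith only [h1, hcomp', hUw', hLw']
    have e2 : (|CU| + |CL|) * (Cb * ((n : ℝ) * n + (n : ℝ) ^ 2)) = (n : ℝ) ^ 2 * (2 * ((|CU| + |CL|) * Cb)) := by ring
    rw [e2] at htot
    have hdiv : γ * n' - (2 * 2 + 2 * (1 / 5)) * a ^ 2 ≤ 2 * ((|CU| + |CL|) * Cb) := le_of_mul_le_mul_left htot hK2
    have : (n' : ℝ) ≤ (2 * ((|CU| + |CL|) * Cb) + (2 * 2 + 2 * (1 / 5)) * a ^ 2) / γ := by
      rw [le_div_iff₀ hγ]; linarith only [hdiv]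
    linarith only [this, hn']
  -- (3) the two conclusions, by contradiction through the engine
  refine ⟨fun m₀ => ?_, fun m₀ => ?_⟩ <;> by_contra hcon
  · -- a non-hollow offset: `2η`-far from the classes, hence `η`-far offsets are syndetic and gain `≥ η²/5`
    obtain ⟨η, hη, hfar⟩ := hc_farOfNotHollow a ha (δ₁ (m₀ + 1) - δ₁ m₀) (hθ₁2 m₀) hcon
    obtain ⟨G, hG⟩ := hc_badOffsetSyndetic a ha B δ₁ z hB hδ₁ hz hgap Z hZ₁ hrec η hη m₀ hfar
    refine engine (fun m => ∀ s i j : ℤ, s = 1 ∨ s = -1 → η ≤ ‖(δ₁ (m + 1) - δ₁ m) -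
        ((s : ℝ) • barlowOffset a + (i : ℝ) • triangularVec₁ a + (j : ℝ) • triangularVec₂ a)‖)
      ((1 / 5 : ℝ) * η ^ 2) (by positivity) (fun m hm => ?_) ⟨G, hG⟩
    obtain ⟨s, i, j, hs, hwm⟩ := hwcls m
    have hηd : η ≤ ‖(δ₁ (m + 1) - δ₁ m) - w m‖ := by rw [hwm]; exact hm s i j hs
    nlinarith [sq_nonneg (max (z (m + 1) - z m - t) 0), mul_self_le_mul_self hη.le hηd]
  · -- a wide gap `g > t`: gaps `≥ t + Δ` are syndetic and gain `≥ Δ²`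
    push Not at hcon
    obtain ⟨Δ, hΔ, hwide⟩ : ∃ Δ : ℝ, 0 < Δ ∧ t + 2 * Δ ≤ z (m₀ + 1) - z m₀ :=
      ⟨(z (m₀ + 1) - z m₀ - t) / 2, by linarith, by linarith⟩
    obtain ⟨G, hG⟩ := hc_wideGapSyndetic a ha B δ₁ z hB hδ₁ hz hgap Z hZ₁ hrec t Δ hΔ m₀ hwide
    refine engine (fun m => t + Δ ≤ z (m + 1) - z m) (1 * Δ ^ 2) (by positivity) (fun m hm => ?_) ⟨G, hG⟩
    have hmax : Δ ≤ max (z (m + 1) - z m - t) 0 := le_trans (by linarith) (le_max_left _ _)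
    nlinarith [sq_nonneg ‖(δ₁ (m + 1) - δ₁ m) - w m‖, mul_self_le_mul_self hΔ.le hmax]

end Summit.AtomisticToContinuum.Crystallization.Theorems.PeriodicWindowsDenseLaminarHull

end
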